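import Summits.KontsevichZagierPeriods.Zeta5Search.PFLinearSteps
import HarnessLib

/-!
# ζ(5) search — PROVED denominators for the dual series `F̃₇(b)` (cell `pub-zeta5`, TYPER)

HONEST FRAMING: systematic search; no irrationality claim unless certified.

OUR theorem (Summit side) about the Literature object `F̃₇(b)` of Brown–Zudilin (arXiv:2210.03391, (34)) in the
cell's partial-fraction language (`DualSeriesDecomposition`: summand `numPoly_b(X)/(X)_{b₀+1}^6`;
`WedgeDictionary.{IsPFData, coeffU, coeffW, coeffV}`). Write `n = b₀`, `f_j = (X)_{b_j}`, `s_j = (X+b₀−b_j+1)_{b_j}`.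
For the six (first, second) pairs `(1,6),(7,1),(2,7),(6,4),(4,5),(5,3)` — Brown–Zudilin's pairs `16,17,27,35,45,46`
of (35) — `f_j s_k/(X)_{n+1} = 1/(X+b_j)_{n+1−b_j−b_k}` is a reciprocal brick on a sub-block, with integer residues
after multiplication by `(n−b_j−b_k)!` (`PFSteps.subBlock_eq_brickEval`); the remaining factors `(2X+b₀)`, `f₃`,
`s₂` are products of integer linear factors (`PFSteps.linSteps`). Hence, with

  `N(b) = ∏_{pairs} (b₀ − b_j − b_k)!`   (`normaliser`; Brown–Zudilin's (35) has moreover `/(b₂! b₃!)`),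

* `exists_int_data` — for `d` any common multiple of `1..b₀`: THE partial-fraction data `c` of `R_b` satisfy
  `d^{5−o} · N(b) · c_{o,p} ∈ ℤ` (`o < 6`, `p ≤ b₀`);
* `coeffU_den`, `coeffW_den`, `coeffV_den` — **`d_{b₀}·N(b)·U(b) ∈ ℤ`, `d_{b₀}³·N(b)·W(b) ∈ ℤ`,
  `d_{b₀}⁶·N(b)·V(b) ∈ ℤ`** (`d_{b₀} = Nat.lcmUpto b₀`), on the box `InBox b` with `Σ_j b_j ≤ 3b₀+1` and the six
  pair conditions `b_j + b_k ≤ b₀`.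

This is the "proved d-inclusion for `F̃₇`" the engines asked for (gen-2 g4, REQUESTS zeta5-gen2-fast-reply-1), in
the generic (Rivoal-type) strength; the printed `F₇(b) ∈ ℚ + ℚζ(3) + ℤζ(5)` under (35) is sharper by `b₂!b₃!` and
by one `d_{b₀}` on `U` (design memo `HOME/pub-zeta5-typer-g5/DESIGN-F7-denominators.md`). 0 sorry.
-/

noncomputable section

open Finset Polynomial
open Literature.NumberTheory.Transcendental
open Literature.NumberTheory.Transcendental.BallRivoal

namespace Summit.KontsevichZagierPeriods.Zeta5Search

namespace DualSeriesDenominators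

open DualSeries WedgeDictionary PFSteps

/-! ### Pochhammer bookkeeping -/

/-- `(x)_{a+m} = (x)_a (x+a)_m`. -/
theorem poch_add (x : ℚ) (a m : ℕ) : poch x (a + m) = poch x a * poch (x + a) m := by
  induction m with
  | zero => simp [poch]
  | succ m ih =>
    unfold poch at ih ⊢
    rw [show a + (m + 1) = (a + m) + 1 by ring, prod_range_succ, prod_range_succ, ih]
    push_cast
    ring

/-- A factor of a nonzero Pochhammer product is nonzero: `(x)_{a+m} ≠ 0 → (x+a)_m ≠ 0` and `(x)_a ≠ 0`. -/
theorem poch_ne_zero_of_add {x : ℚ} {a m : ℕ} (h : poch x (a + m) ≠ 0) :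
    poch x a ≠ 0 ∧ poch (x + a) m ≠ 0 := by
  rw [poch_add] at h
  exact ⟨left_ne_zero_of_mul h, right_ne_zero_of_mul h⟩

/-- `linProd` of the list `[(1, e), (1, e+1), …, (1, e+m−1)]` is `(t+e)_m`. -/
theorem linProd_range (e : ℤ) (m : ℕ) (t : ℚ) :
    linProd ((List.range m).map fun i : ℕ => ((1 : ℤ), e + (i : ℤ))) t = poch (t + e) m := by
  induction m with
  | zero => simp [linProd, poch]
  | succ m ih =>
    unfold linProd at ih ⊢
    unfold poch at ih ⊢
    rw [List.range_succ, List.map_append, List.map_append, List.prod_append, ih, prod_range_succ]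
    simp only [List.map_cons, List.map_nil, List.prod_cons, List.prod_nil]
    push_cast
    ring

/-- `linProd` is multiplicative on appended lists. -/
theorem linProd_append (L₁ L₂ : List (ℤ × ℤ)) (t : ℚ) :
    linProd (L₁ ++ L₂) t = linProd L₁ t * linProd L₂ t := by
  simp [linProd, List.map_append, List.prod_append]

/-! ### The core algebraic identity (atoms as variables) -/

/-- Regrouping `N·(ℓ·∏_j f_j s_j)/P⁶` into `(ℓ f₃ s₂)·∏_{pairs} N_s/m_s` given the six factorisations
`P = f_j m_s s_k`. -/
theorem regroup {K : Type*} [Field K]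
    (ℓ f1 f2 f3 f4 f5 f6 f7 s1 s2 s3 s4 s5 s6 s7 m1 m2 m3 m4 m5 m6 N1 N2 N3 N4 N5 N6 P : K)
    (h1 : P = f1 * m1 * s6) (h2 : P = f7 * m2 * s1) (h3 : P = f2 * m3 * s7)
    (h4 : P = f6 * m4 * s4) (h5 : P = f4 * m5 * s5) (h6 : P = f5 * m6 * s3)
    (hm1 : m1 ≠ 0) (hm2 : m2 ≠ 0) (hm3 : m3 ≠ 0) (hm4 : m4 ≠ 0) (hm5 : m5 ≠ 0) (hm6 : m6 ≠ 0)
    (hP : P ≠ 0) :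
    (N1 * N2 * N3 * N4 * N5 * N6) *
        ((ℓ * ((f1 * s1) * (f2 * s2) * (f3 * s3) * (f4 * s4) * (f5 * s5) * (f6 * s6) * (f7 * s7))) / P ^ 6)
      = (ℓ * f3 * s2) * ((N1 / m1) * (N2 / m2) * (N3 / m3) * (N4 / m4) * (N5 / m5) * (N6 / m6)) := by
  have hf1 : f1 ≠ 0 := by intro h; apply hP; rw [h1, h]; ring
  have hs6 : s6 ≠ 0 := by intro h; apply hP; rw [h1, h]; ring
  have hf7 : f7 ≠ 0 := by intro h; apply hP; rw [h2, h]; ring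
  have hs1 : s1 ≠ 0 := by intro h; apply hP; rw [h2, h]; ring
  have hf2 : f2 ≠ 0 := by intro h; apply hP; rw [h3, h]; ring
  have hs7 : s7 ≠ 0 := by intro h; apply hP; rw [h3, h]; ring
  have hf6 : f6 ≠ 0 := by intro h; apply hP; rw [h4, h]; ring
  have hs4 : s4 ≠ 0 := by intro h; apply hP; rw [h4, h]; ring
  have hf4 : f4 ≠ 0 := by intro h; apply hP; rw [h5, h]; ring
  have hs5 : s5 ≠ 0 := by intro h; apply hP; rw [h5, h]; ring
  have hf5 : f5 ≠ 0 := by intro h; apply hP; rw [h6, h]; ring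
  have hs3 : s3 ≠ 0 := by intro h; apply hP; rw [h6, h]; ring
  have hP6 : P ^ 6 = (f1 * m1 * s6) * (f7 * m2 * s1) * (f2 * m3 * s7) * (f6 * m4 * s4) * (f4 * m5 * s5)
      * (f5 * m6 * s3) := by rw [← h1, ← h2, ← h3, ← h4, ← h5, ← h6]; ring
  rw [hP6]
  field_simp

/-! ### The objects for `F̃₇(b)` -/

/-- The parameters as naturals (`b_j ≥ 0` on the box). -/
def bn (b : ℕ → ℤ) (j : ℕ) : ℕ := (b j).toNat

/-- First index of the `s`-th pair: `(1,6),(7,1),(2,7),(6,4),(4,5),(5,3)`. -/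
def pfst : ℕ → ℕ
  | 0 => 1 | 1 => 7 | 2 => 2 | 3 => 6 | 4 => 4 | _ => 5

/-- Second index of the `s`-th pair. -/
def psnd : ℕ → ℕ
  | 0 => 6 | 1 => 1 | 2 => 7 | 3 => 4 | 4 => 5 | _ => 3

/-- Length `L_s = b₀ + 1 − b_j − b_k` of the middle block of the `s`-th pair. -/
def blockLen (b : ℕ → ℤ) (s : ℕ) : ℕ := bn b 0 + 1 - bn b (pfst s) - bn b (psnd s)

/-- **The normaliser** `N(b) = ∏_{pairs} (b₀ − b_j − b_k)!` (Brown–Zudilin's (35) without the division by `b₂!b₃!`). -/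
def normaliser (b : ℕ → ℤ) : ℕ := ∏ s ∈ range 6, (blockLen b s - 1).factorial

/-- The residues of the six sub-block bricks. -/
def brickA (b : ℕ → ℤ) : ℕ → ℕ → ℤ := fun s => subRes (bn b (pfst s)) (blockLen b s)

/-- The integer linear factors `2t + (b₀+2)`, `t + 1 + i` (`i < b₃`), `t + (b₀ − b₂ + 2) + i` (`i < b₂`). -/
def linFactors (b : ℕ → ℤ) : List (ℤ × ℤ) :=
  ((2 : ℤ), (bn b 0 : ℤ) + 2) ::
    (((List.range (bn b 3)).map fun i : ℕ => ((1 : ℤ), (1 : ℤ) + (i : ℤ)))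
      ++ ((List.range (bn b 2)).map fun i : ℕ => ((1 : ℤ), ((bn b 0 : ℤ) - bn b 2 + 2) + (i : ℤ))))

/-- First factor `f_j = (t+1)_{b_j}`. -/
def fF (b : ℕ → ℤ) (t : ℚ) (j : ℕ) : ℚ := poch (t + 1) (bn b j)

/-- Second factor `s_j = (t+1 + (b₀ − b_j + 1))_{b_j}`. -/
def sF (b : ℕ → ℤ) (t : ℚ) (j : ℕ) : ℚ := poch (t + 1 + ((bn b 0 : ℚ) - bn b j + 1)) (bn b j)

/-- Middle block `m_s = (t+1+b_j)_{L_s}` of the `s`-th pair. -/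
def mF (b : ℕ → ℤ) (t : ℚ) (s : ℕ) : ℚ := poch (t + 1 + bn b (pfst s)) (blockLen b s)

/-- The very-well-poised linear factor `2(t+1) + b₀`. -/
def ell (b : ℕ → ℤ) (t : ℚ) : ℚ := 2 * t + bn b 0 + 2

/-! ### The pieces of the product identity -/

/-- `(t+1)_{n+1} ≠ 0` away from the poles. -/
theorem poch_block_ne_zero (n : ℕ) (t : ℚ) (ht : ∀ p, p ≤ n → t + p + 1 ≠ 0) :
    poch (t + 1) (n + 1) ≠ 0 := by
  rw [poch]
  exact prod_ne_zero_iff.2 fun m hm h => ht m (Nat.lt_succ_iff.1 (mem_range.1 hm)) (by linarith)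

/-- On the box, `(b_j : ℚ) = bn b j`. -/
theorem cast_bn {b : ℕ → ℤ} (hb : InBox b) (j : ℕ) (hj : j ≤ 7) : ((b j : ℤ) : ℚ) = (bn b j : ℚ) := by
  have h0 : 0 ≤ b j := by
    rcases Nat.eq_zero_or_pos j with rfl | hpos
    · exact hb.1
    · obtain ⟨i, rfl⟩ : ∃ i, j = i + 1 := ⟨j - 1, by omega⟩
      exact (hb.2 i (mem_range.2 (by omega))).1
  rw [bn, show ((b j : ℤ) : ℚ) = (((b j).toNat : ℤ) : ℚ) by rw [Int.toNat_of_nonneg h0]]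
  norm_cast

/-- (E1) The numerator: `numPoly_b(t+1) = ℓ · ∏_{j=1}^{7} f_j s_j`. -/
theorem numerator_eq {b : ℕ → ℤ} (hb : InBox b) (t : ℚ) :
    ((numPoly b).comp (X + C 1)).eval t
      = ell b t * ((fF b t 1 * sF b t 1) * (fF b t 2 * sF b t 2) * (fF b t 3 * sF b t 3) * (fF b t 4 * sF b t 4)
          * (fF b t 5 * sF b t 5) * (fF b t 6 * sF b t 6) * (fF b t 7 * sF b t 7)) := by
  rw [eval_comp, eval_add, eval_X, eval_C, eval_numPoly]
  have hj : ∀ j ∈ range 7, poch (t + 1) (b (j + 1)).toNat *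
      poch (t + 1 + ((b 0 - b (j + 1) + 1 : ℤ) : ℚ)) (b (j + 1)).toNat = fF b t (j + 1) * sF b t (j + 1) := by
    intro j hjm
    have hj7 : j + 1 ≤ 7 := by have := mem_range.1 hjm; omega
    rw [fF, sF, bn]
    congr 2
    push_cast
    rw [cast_bn hb 0 (by norm_num), cast_bn hb (j + 1) hj7, bn, bn]
  rw [prod_congr rfl hj, cast_bn hb 0 (by norm_num), ell]
  simp only [prod_range_succ, prod_range_zero, one_mul]
  ring

/-- (E2) The normaliser as a product of six factorials (cast). -/
theorem cast_normaliser (b : ℕ → ℤ) :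
    (normaliser b : ℚ) = ((blockLen b 0 - 1).factorial : ℚ) * ((blockLen b 1 - 1).factorial : ℚ)
      * ((blockLen b 2 - 1).factorial : ℚ) * ((blockLen b 3 - 1).factorial : ℚ)
      * ((blockLen b 4 - 1).factorial : ℚ) * ((blockLen b 5 - 1).factorial : ℚ) := by
  rw [normaliser]
  push_cast
  simp only [prod_range_succ, prod_range_zero, one_mul]

/-- (E3) The `s`-th factorisation of the block: `(t+1)_{n+1} = f_j · m_s · s_k`. -/
theorem block_eq_pair {b : ℕ → ℤ} (hP : ∀ s, s < 6 → bn b (pfst s) + bn b (psnd s) ≤ bn b 0) (t : ℚ) (s : ℕ) (hs : s < 6) :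
    poch (t + 1) (bn b 0 + 1) = fF b t (pfst s) * mF b t s * sF b t (psnd s) := by
  have hle := hP s hs
  have hsplit : bn b 0 + 1 = bn b (pfst s) + (blockLen b s + bn b (psnd s)) := by
    unfold blockLen; omega
  have this : ((bn b (pfst s) : ℕ) : ℚ) + (blockLen b s : ℕ) = (bn b 0 : ℚ) - bn b (psnd s) + 1 := by
    have e : bn b (pfst s) + blockLen b s = bn b 0 + 1 - bn b (psnd s) := by unfold blockLen; omega
    have e' : ((bn b (pfst s) + blockLen b s : ℕ) : ℚ) = ((bn b 0 + 1 - bn b (psnd s) : ℕ) : ℚ) := by rw [e]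
    push_cast [Nat.cast_sub (show bn b (psnd s) ≤ bn b 0 + 1 by omega)] at e'
    linarith
  have hX : t + 1 + ((bn b (pfst s) : ℕ) : ℚ) + ((blockLen b s : ℕ) : ℚ)
      = t + 1 + (((bn b 0 : ℕ) : ℚ) - ((bn b (psnd s) : ℕ) : ℚ) + 1) := by linarith
  rw [hsplit, poch_add, poch_add, fF, mF, sF, hX, mul_assoc]

/-- (E4) The `s`-th brick is the sub-block brick: `brickEval n (brickA b s) t = (L_s−1)!/m_s`. -/
theorem brick_eq {b : ℕ → ℤ} (hP : ∀ s, s < 6 → bn b (pfst s) + bn b (psnd s) ≤ bn b 0) (t : ℚ) (ht : ∀ p, p ≤ bn b 0 → t + p + 1 ≠ 0)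
    (s : ℕ) (hs : s < 6) :
    brickEval (bn b 0) (brickA b s) t = (((blockLen b s - 1).factorial : ℕ) : ℚ) / mF b t s := by
  have hle := hP s hs
  rw [brickA, mF, ← subBlock_eq_brickEval (bn b 0) (bn b (pfst s)) (blockLen b s)
    (by unfold blockLen; omega) (by unfold blockLen; omega) t ht]
  congr 2
  ring

/-- (E5) The linear factors multiply to `ℓ · f₃ · s₂`. -/
theorem linProd_linFactors (b : ℕ → ℤ) (t : ℚ) :
    linProd (linFactors b) t = ell b t * fF b t 3 * sF b t 2 := by
  rw [linFactors, linProd, List.map_cons, List.prod_cons, ← linProd, linProd_append, linProd_range,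
    linProd_range, ell, fF, sF]
  push_cast
  have e : t + (((bn b 0 : ℕ) : ℚ) - (bn b 2 : ℕ) + 2) = t + 1 + ((bn b 0 : ℚ) - bn b 2 + 1) := by ring
  rw [e]
  ring

/-- **The product identity**: `N(b) · numPoly_b(t+1)/(t+1)_{n+1}^6 = (ℓ f₃ s₂) · ∏_{s<6} brick_s(t)`. -/
theorem normaliser_mul_eq {b : ℕ → ℤ} (hb : InBox b) (hP : ∀ s, s < 6 → bn b (pfst s) + bn b (psnd s) ≤ bn b 0) (t : ℚ)
    (ht : ∀ p, p ≤ bn b 0 → t + p + 1 ≠ 0) :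
    (normaliser b : ℚ) * (((numPoly b).comp (X + C 1)).eval t / poch (t + 1) (bn b 0 + 1) ^ 6)
      = linProd (linFactors b) t * ∏ s ∈ range 6, brickEval (bn b 0) (brickA b s) t := by
  have hPne := poch_block_ne_zero (bn b 0) t ht
  have hm : ∀ s, s < 6 → mF b t s ≠ 0 := by
    intro s hs h
    apply hPne
    rw [block_eq_pair hP t s hs, h, mul_zero, zero_mul]
  rw [numerator_eq hb, cast_normaliser, linProd_linFactors]
  simp only [prod_range_succ, prod_range_zero, one_mul]
  rw [brick_eq hP t ht 0 (by norm_num), brick_eq hP t ht 1 (by norm_num), brick_eq hP t ht 2 (by norm_num),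
    brick_eq hP t ht 3 (by norm_num), brick_eq hP t ht 4 (by norm_num), brick_eq hP t ht 5 (by norm_num)]
  exact regroup (ell b t) (fF b t 1) (fF b t 2) (fF b t 3) (fF b t 4) (fF b t 5) (fF b t 6) (fF b t 7)
    (sF b t 1) (sF b t 2) (sF b t 3) (sF b t 4) (sF b t 5) (sF b t 6) (sF b t 7)
    (mF b t 0) (mF b t 1) (mF b t 2) (mF b t 3) (mF b t 4) (mF b t 5) _ _ _ _ _ _ _
    (block_eq_pair hP t 0 (by norm_num)) (block_eq_pair hP t 1 (by norm_num))
    (block_eq_pair hP t 2 (by norm_num)) (block_eq_pair hP t 3 (by norm_num))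
    (block_eq_pair hP t 4 (by norm_num)) (block_eq_pair hP t 5 (by norm_num))
    (hm 0 (by norm_num)) (hm 1 (by norm_num)) (hm 2 (by norm_num)) (hm 3 (by norm_num))
    (hm 4 (by norm_num)) (hm 5 (by norm_num)) hPne

/-! ### Integrality of THE partial-fraction data -/

/-- `k ∣ D_n` for `1 ≤ k ≤ n`. -/
theorem natCast_dvd_lcmUpto {k n : ℕ} (h1 : 1 ≤ k) (h2 : k ≤ n) : (k : ℤ) ∣ ((Nat.lcmUpto n : ℕ) : ℤ) := by
  have : k ∈ Icc 1 n := mem_Icc.2 ⟨h1, h2⟩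
  have h := Finset.dvd_lcm (f := id) this
  have h' : k ∣ Nat.lcmUpto n := by simpa [Nat.lcmUpto] using h
  exact_mod_cast h'

/-- **`d^{5−o}·N(b)·c_{o,p} ∈ ℤ` for THE partial-fraction data of `R_b`** (`o < 6`, `p ≤ b₀`; `d` any common
multiple of `1, …, b₀`), on the box with `Σ_j b_j ≤ 3b₀ + 1` and the six pair conditions. -/
theorem exists_int_data {b : ℕ → ℤ} (hb : InBox b)
    (hP : ∀ s, s < 6 → bn b (pfst s) + bn b (psnd s) ≤ bn b 0)
    (hsum : ∑ j ∈ range 7, b (j + 1) ≤ 3 * b 0 + 1)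
    (d : ℕ) (hdiv : ∀ k : ℕ, 1 ≤ k → k ≤ bn b 0 → (k : ℤ) ∣ d) :
    ∃ c : ℕ → ℕ → ℚ, IsPFData b c ∧
      ∀ o p, o < 6 → p ≤ bn b 0 → ∃ z : ℤ, (d : ℚ) ^ (5 - o) * ((normaliser b : ℚ) * c o p) = z := by
  obtain ⟨c₀, hc₀, hint₀, -⟩ := exists_pf_prod (bn b 0) d hdiv (brickA b) 6 (by norm_num)
  have hc₁s : ∀ o p, 6 ≤ o → trunc 6 c₀ o p = 0 := fun o p ho => trunc_of_le ho p
  have hint₂ : IsInt 6 d (linSteps (linFactors b) (trunc 6 c₀)) :=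
    isInt_linSteps hc₁s (isInt_trunc hint₀) _
  obtain ⟨c, hc⟩ := exists_isPFData b hb hsum
  refine ⟨c, hc, ?_⟩
  -- the identity at the naturals
  have hnat : ∀ k : ℕ, 0 ≤ k →
      pfEval (bn b 0) 6 (fun o p => linSteps (linFactors b) (trunc 6 c₀) o p - (normaliser b : ℚ) * c o p) k
        + (polyPart (bn b 0) (linFactors b) (trunc 6 c₀)).eval (k : ℚ) = 0 := by
    intro k _
    have hk : ∀ p, p ≤ bn b 0 → (k : ℚ) + p + 1 ≠ 0 := fun p _ => by positivity
    have h1 := pfEval_linSteps (bn b 0) 6 hc₁s (k : ℚ) hk (linFactors b)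
    have h2 : pfEval (bn b 0) 6 (trunc 6 c₀) k = ∏ s ∈ range 6, brickEval (bn b 0) (brickA b s) k := by
      rw [pfEval_trunc]; exact hc₀ k hk
    have h3 := normaliser_mul_eq hb hP (k : ℚ) hk
    have h4 : pfEval (bn b 0) 6 c k
        = ((numPoly b).comp (X + C 1)).eval (k : ℚ) / poch ((k : ℚ) + 1) (bn b 0 + 1) ^ 6 := hc (k : ℚ) hk
    rw [pfEval_sub', pfEval_const_mul, h4]
    rw [h2, ← h3] at h1
    linear_combination h1
  obtain ⟨-, hzero⟩ := pf_unique_poly (bn b 0) 6 _ _ 0 hnat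
  intro o p ho hp
  obtain ⟨z, hz⟩ := hint₂ o p
  refine ⟨z, ?_⟩
  have e : (normaliser b : ℚ) * c o p = linSteps (linFactors b) (trunc 6 c₀) o p := by
    have := hzero o p ho hp
    linarith
  rw [e, ← hz, show (6 : ℕ) - 1 - o = 5 - o by omega]

/-! ### Denominators of `U(b)`, `W(b)`, `V(b)` -/

/-- **`d_{b₀} · N(b) · U(b) ∈ ℤ`** (`U(b) = coeffU b`, the canonical `ζ(5)`-coefficient of `F̃₇(b)`). -/
theorem coeffU_den {b : ℕ → ℤ} (hb : InBox b)
    (hP : ∀ s, s < 6 → bn b (pfst s) + bn b (psnd s) ≤ bn b 0)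
    (hsum : ∑ j ∈ range 7, b (j + 1) ≤ 3 * b 0 + 1) :
    ∃ z : ℤ, ((Nat.lcmUpto (bn b 0) : ℕ) : ℚ) * (normaliser b : ℚ) * coeffU b = z := by
  obtain ⟨c, hc, hint⟩ := exists_int_data hb hP hsum (Nat.lcmUpto (bn b 0))
    (fun k h1 h2 => natCast_dvd_lcmUpto h1 h2)
  have hterm : ∀ p ∈ range (bn b 0 + 1), ∃ z : ℤ,
      ((Nat.lcmUpto (bn b 0) : ℕ) : ℚ) * (normaliser b : ℚ) * c 4 p = z := by
    intro p hp
    obtain ⟨z, hz⟩ := hint 4 p (by norm_num) (Nat.lt_succ_iff.1 (mem_range.1 hp))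
    refine ⟨z, ?_⟩
    rw [← hz, show (5 : ℕ) - 4 = 1 by rfl, pow_one]
    ring
  choose z hz using hterm
  refine ⟨∑ p ∈ (range (bn b 0 + 1)).attach, z p.1 p.2, ?_⟩
  rw [coeffU_eq hc, show (b 0).toNat = bn b 0 by rfl, mul_sum, ← sum_attach]
  push_cast
  exact sum_congr rfl fun p _ => hz p.1 p.2

/-- **`d_{b₀}³ · N(b) · W(b) ∈ ℤ`** (`W(b) = coeffW b`, the canonical `ζ(3)`-coefficient). -/
theorem coeffW_den {b : ℕ → ℤ} (hb : InBox b)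
    (hP : ∀ s, s < 6 → bn b (pfst s) + bn b (psnd s) ≤ bn b 0)
    (hsum : ∑ j ∈ range 7, b (j + 1) ≤ 3 * b 0 + 1) :
    ∃ z : ℤ, ((Nat.lcmUpto (bn b 0) : ℕ) : ℚ) ^ 3 * (normaliser b : ℚ) * coeffW b = z := by
  obtain ⟨c, hc, hint⟩ := exists_int_data hb hP hsum (Nat.lcmUpto (bn b 0))
    (fun k h1 h2 => natCast_dvd_lcmUpto h1 h2)
  have hterm : ∀ p ∈ range (bn b 0 + 1), ∃ z : ℤ,
      ((Nat.lcmUpto (bn b 0) : ℕ) : ℚ) ^ 3 * (normaliser b : ℚ) * c 2 p = z := by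
    intro p hp
    obtain ⟨z, hz⟩ := hint 2 p (by norm_num) (Nat.lt_succ_iff.1 (mem_range.1 hp))
    refine ⟨z, ?_⟩
    rw [← hz, show (5 : ℕ) - 2 = 3 by rfl]
    ring
  choose z hz using hterm
  refine ⟨∑ p ∈ (range (bn b 0 + 1)).attach, z p.1 p.2, ?_⟩
  rw [coeffW_eq hc, show (b 0).toNat = bn b 0 by rfl, mul_sum, ← sum_attach]
  push_cast
  exact sum_congr rfl fun p _ => hz p.1 p.2

/-- **`d_{b₀}⁶ · N(b) · V(b) ∈ ℤ`** (`V(b) = coeffV b`, the canonical constant term, with the truncated zeta sums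
`H_p^{(o+1)}` cleared by `d_{b₀}^{o+1}`, `BallRivoal.isInt_dpow_mul_harm`). -/
theorem coeffV_den {b : ℕ → ℤ} (hb : InBox b)
    (hP : ∀ s, s < 6 → bn b (pfst s) + bn b (psnd s) ≤ bn b 0)
    (hsum : ∑ j ∈ range 7, b (j + 1) ≤ 3 * b 0 + 1) :
    ∃ z : ℤ, ((Nat.lcmUpto (bn b 0) : ℕ) : ℚ) ^ 6 * (normaliser b : ℚ) * coeffV b = z := by
  have hdiv : ∀ k : ℕ, 1 ≤ k → k ≤ bn b 0 → (k : ℤ) ∣ ((Nat.lcmUpto (bn b 0) : ℕ) : ℤ) :=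
    fun k h1 h2 => natCast_dvd_lcmUpto h1 h2
  obtain ⟨c, hc, hint⟩ := exists_int_data hb hP hsum (Nat.lcmUpto (bn b 0)) hdiv
  have hterm : ∀ o ∈ range 6, ∀ p ∈ range (bn b 0 + 1), ∃ z : ℤ,
      ((Nat.lcmUpto (bn b 0) : ℕ) : ℚ) ^ 6 * (normaliser b : ℚ) * (c o p * harm (o + 1) p) = z := by
    intro o ho p hp
    have ho' := mem_range.1 ho
    have hp' := Nat.lt_succ_iff.1 (mem_range.1 hp)
    obtain ⟨z, hz⟩ := hint o p ho' hp'
    obtain ⟨w, hw⟩ := isInt_dpow_mul_harm (bn b 0) (Nat.lcmUpto (bn b 0)) hdiv (o + 1) p hp'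
    refine ⟨z * w, ?_⟩
    have e : (6 : ℕ) = (5 - o) + (o + 1) := by omega
    rw [e, pow_add]
    push_cast
    rw [← hz, ← hw]
    ring
  choose z hz using hterm
  refine ⟨∑ o ∈ (range 6).attach, ∑ p ∈ (range (bn b 0 + 1)).attach, z o.1 o.2 p.1 p.2, ?_⟩
  have hV : coeffV b = ∑ o ∈ range 6, ∑ p ∈ range (bn b 0 + 1), c o p * harm (o + 1) p := by
    rw [coeffV, show (b 0).toNat = bn b 0 by rfl]
    refine sum_congr rfl fun o ho => sum_congr rfl fun p hp => ?_
    rw [(isPFData_pfData hc).eq hc (mem_range.1 ho) (Nat.lt_succ_iff.1 (mem_range.1 hp))]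
  rw [hV, mul_sum, ← sum_attach]
  push_cast
  refine sum_congr rfl fun o _ => ?_
  rw [mul_sum, ← sum_attach]
  exact sum_congr rfl fun p _ => hz o.1 o.2 p.1 p.2

end DualSeriesDenominators

end Summit.KontsevichZagierPeriods.Zeta5Search
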